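import Literature.MathematicalPhysics.QuantumLattice.AnisotropicXYKuboInequality
import Literature.MathematicalPhysics.QuantumLattice.AnisotropicKLSMargin
import Literature.MathematicalPhysics.QuantumLattice.AnisotropicXYSumRuleEnergyBounds
import HarnessLib

/-!
# Long-range order in the quantum XY model with direction-dependent couplings (layered hard-core
# bosons), ground state and low temperature, by the Kennedy–Lieb–Shastry sum-rule argument

Topic `MathematicalPhysics/QuantumLattice`; the assembly of the chain
`AnisotropicXYGaussianDomination` → `AnisotropicXYInfraredBound` /
`AnisotropicXYThermalInfraredBound` → `AnisotropicXYKuboInequality` →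
`AnisotropicXYSumRuleEnergyBounds`, through the model-free
endgame `AnisotropicKLSMargin`. No definition and no named fact is introduced.

## What is printed, and what is proved here

[KLS1988JSP] §3 treats the model "which interpolates between two and three dimensions" with
nearest-neighbour couplings `1, 1, r` (eq. (5)) in the ground state and remarks (p. 1020) that
"the techniques we use may be combined with the techniques of Dyson et al. for nonzero
temperatures to prove the existence of a phase transition"; [KLS1988PRL] eqs. (4)–(8) is the
sum-rule argument for the XY model. For the ferromagnetic quantum XY model of spin `S = n/2` with
direction-dependent couplings `K > 0` on the even tori `(ℤ/2kℤ)^d`,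
`H_K = -Σ_xΣᵢ Kᵢ(S¹_xS¹_{x+eᵢ} + S²_xS²_{x+eᵢ})` (hard-core bosons with direction-dependent
hopping for `S = ½`), this file proves:

* `xyAniso_kls_ineq7_ground` — [KLS1988PRL] eq. (7) for `H_K` on every even torus of side
  `L ≥ 4`: `ē_K/κ_K ≤ |Λ|⁻¹ĝ¹_K(0) + ½(ē_K/κ_K)^{1/2} R^K_L`, `ē_K = Σᵢ Kᵢ e₁^{(i)}`, `κ_K = Σᵢ Kᵢ`;
  `xyAniso_kls_ineq7_thermal` — the same at inverse temperature `β` with `+ (2β)⁻¹J^K_L`;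
* `xyAniso_longRangeOrder_ground` — **ground-state long-range order**: if the punctured Riemann
  sums `R^K_L` of the anisotropic KLS integrand are eventually `≤ ρ` with `ρ < S√2 = n√2/2`, then
  `liminf_k (2k)^{-2d}Σ_{x,y}(G¹_K + G²_K) ≥ 2(s - ½√s ρ₊) > 0`, `s = ½S²`
  (`HasEvenTorusLRO`);
* `xyAniso_longRangeOrder_thermal` — **long-range order at low temperature**: if moreover
  `J^K_L ≤ 𝒯` eventually, there is `β₀ > 0` with `HasEvenTorusLRO` of the thermal two-component
  correlation for every `β ≥ β₀`.

The remaining analytic input — the values of `lim R^K_L` and `lim J^K_L` as lattice integrals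
(`d ≥ 2`, resp. `d ≥ 3` for `J`) for the given `K`, e.g. `K = (1, 1, r)` — is a statement about
explicit finite-dimensional integrals, not about the quantum model, and is left to the consumer
(as `klsRiemannSum_tendsto` / `klsIntegral_two_le` are separate inputs of the isotropic
`kennedy_lieb_shastry_xy_ground_of_facts`).

## References

* [KLS1988PRL] T. Kennedy, E. H. Lieb, B. S. Shastry, Phys. Rev. Lett. 61 (1988) 2582–2584,
  Theorem, eqs. (4)–(8).
* [KLS1988JSP] T. Kennedy, E. H. Lieb, B. S. Shastry, J. Stat. Phys. 53 (1988) 1019–1030, §3,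
  eqs. (5)–(9), p. 1020.
* [DLS1978] F. J. Dyson, E. H. Lieb, B. Simon, J. Stat. Phys. 18 (1978) 335–383, Thms. 5.1, 5.2.
-/

noncomputable section

open Filter Topology Matrix Finset
open Literature.MathematicalPhysics.QuantumLattice Literature.Probability.LatticeModels
  Literature.MathematicalPhysics.QuantumLattice.XYOrderProofs
  Literature.Barriers.AtomisticToContinuum.BoseGas

namespace Literature.MathematicalPhysics.QuantumLattice

variable {d : ℕ}

/-! ### Constants -/

/-- `√(½S²) = S/√2 = n√2/4` for `S = n/2`. [folklore] -/
private theorem sqrt_half_sq (n : ℕ) :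
    Real.sqrt (((n : ℝ) / 2) ^ 2 / 2) = n * Real.sqrt 2 / 4 := by
  have h2 : ((n : ℝ) / 2) ^ 2 / 2 = (n * Real.sqrt 2 / 4) ^ 2 := by
    rw [div_pow, div_pow, mul_pow, Real.sq_sqrt (by norm_num : (0 : ℝ) ≤ 2)]
    ring
  rw [h2, Real.sqrt_sq (by positivity)]

/-- `κ_K = Σᵢ Kᵢ > 0` for `K > 0`, `d ≥ 1`. [folklore] -/
private theorem sum_coupling_pos (hd : 1 ≤ d) {K : Fin d → ℝ} (hK : ∀ i, 0 < K i) :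
    0 < ∑ i, K i := by
  obtain ⟨i⟩ : Nonempty (Fin d) := ⟨⟨0, hd⟩⟩
  exact lt_of_lt_of_le (hK i) (single_le_sum (fun j _ => (hK j).le) (mem_univ i))

/-- Even sides `2k → ∞`. [folklore] -/
private theorem tendsto_two_mul_atTop' : Tendsto (fun k : ℕ => 2 * k) atTop atTop :=
  tendsto_atTop_atTop.2 fun b => ⟨b, fun k hk => by omega⟩

/-! ### Ground state -/

section Ground

/-- **[KLS1988PRL] eq. (7) for `H_K` in the ground state**: on the even torus of side `L ≥ 4`,
`K > 0` (`d ≥ 1`), `ē_K/κ_K ≤ |Λ|⁻¹ĝ¹_K(0) + ½(ē_K/κ_K)^{1/2} R^K_L` with `ē_K = Σᵢ Kᵢ e₁^{(i)}`,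
`κ_K = Σᵢ Kᵢ` (infrared bound in Kubo form + weighted sum rule).
[cite: KLS1988PRL, eq. (7)] [cite: KLS1988JSP, eqs. (8)–(9)] -/
theorem xyAniso_kls_ineq7_ground (hd : 1 ≤ d) (L : ℕ) [NeZero L] (n : ℕ) {K : Fin d → ℝ}
    (hK : ∀ i, 0 < K i) (hL : Even L) (h4 : 4 ≤ L) :
    (∑ i, K i * xyAnisoDirBondCorr 0 L n K i) / (∑ i, K i) ≤
      xyAnisoStructureFactor 0 L n K 0 / (L : ℝ) ^ d +
        1 / 2 * Real.sqrt ((∑ i, K i * xyAnisoDirBondCorr 0 L n K i) / ∑ i, K i) *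
          anisoKlsRiemannSum K L :=
  anisoKls_ineq7_ground hd L hK (fun q => xyAnisoStructureFactor 0 L n K q)
    (fun q hq => xyAniso_infraredBound_ground_kubo L n K hL h4 hK q hq)
    (by simpa only [anisoCosSum] using xyAnisoStructureFactor_weightedSumRule L n K 0)

/-- **Ground-state long-range order for direction-dependent couplings** (Kennedy–Lieb–Shastry's
theorem for `H_K`, modulo the lattice integral): `d ≥ 1`, `K > 0`, spin `S = n/2 ≥ ½`; if the
punctured Riemann sums `R^K_L` (`anisoKlsRiemannSum`) are eventually `≤ ρ` with `ρ < n√2/2 = 2√s`,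
`s = ½S²`, then the LRO sequence `(2k)^{-2d}Σ_{x,y}(G¹_K + G²_K) = 2|Λ|⁻¹ĝ¹_K(0)` of the tracial
ground states on the even tori has `liminf ≥ 2(s - ½√s ρ₊) > 0`; in particular
`HasEvenTorusLRO`. [cite: KLS1988PRL, Theorem, eqs. (7)–(8)] [cite: KLS1988JSP, §3] -/
theorem xyAniso_longRangeOrder_ground (hd : 1 ≤ d) {K : Fin d → ℝ} (hK : ∀ i, 0 < K i) {n : ℕ}
    (hn : 1 ≤ n) {ρ : ℝ} (hρ : ρ < n * Real.sqrt 2 / 2)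
    (hR : ∀ᶠ L : ℕ in atTop, anisoKlsRiemannSum K L ≤ ρ) :
    HasEvenTorusLRO (fun L x y => xyAnisoGroundCorr 0 L n K x y + xyAnisoGroundCorr 1 L n K x y) ∧
      2 * (((n : ℝ) / 2) ^ 2 / 2 - 1 / 2 * Real.sqrt (((n : ℝ) / 2) ^ 2 / 2) * max ρ 0) ≤
        liminf (fun k : ℕ => (∑ x ∈ halfOpenBox d (2 * k), ∑ y ∈ halfOpenBox d (2 * k),
          torusPullback (fun L x y => xyAnisoGroundCorr 0 L n K x y + xyAnisoGroundCorr 1 L n K x y)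
            (2 * k) x y) / ((halfOpenBox d (2 * k)).card : ℝ) ^ 2) atTop := by
  set s : ℝ := ((n : ℝ) / 2) ^ 2 / 2 with hs_def
  have hn1 : (1 : ℝ) ≤ n := by exact_mod_cast hn
  have hs : 0 < s := by positivity
  have hκ : 0 < ∑ i, K i := sum_coupling_pos hd hK
  have hρ' : ρ < 2 * Real.sqrt s := by rw [hs_def, sqrt_half_sq]; linarith
  have hRk : ∀ᶠ k : ℕ in atTop, anisoKlsRiemannSum K (2 * k) ≤ ρ :=
    tendsto_two_mul_atTop'.eventually hR
  -- eventually: eq. (7), the variational bound, and the order parameter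
  have hev : ∀ᶠ k : ℕ in atTop, ∃ e g : ℝ,
      (∑ x ∈ halfOpenBox d (2 * k), ∑ y ∈ halfOpenBox d (2 * k),
          torusPullback (fun L x y => xyAnisoGroundCorr 0 L n K x y + xyAnisoGroundCorr 1 L n K x y)
            (2 * k) x y) / ((halfOpenBox d (2 * k)).card : ℝ) ^ 2 = 2 * g ∧
        e ≤ g + 1 / 2 * Real.sqrt e * anisoKlsRiemannSum K (2 * k) ∧ s ≤ e := by
    filter_upwards [eventually_ge_atTop 2] with k hk2
    haveI : NeZero (2 * k) := ⟨by omega⟩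
    refine ⟨(∑ i, K i * xyAnisoDirBondCorr 0 (2 * k) n K i) / ∑ i, K i,
      xyAnisoStructureFactor 0 (2 * k) n K 0 / ((2 * k : ℕ) : ℝ) ^ d,
      xyAniso_lroSeq_eq n K k (by omega),
      xyAniso_kls_ineq7_ground hd (2 * k) n hK ⟨k, by ring⟩ (by omega), ?_⟩
    rw [hs_def, le_div_iff₀ hκ]
    exact xyAniso_weightedBondCorr_lower (2 * k) n K (by omega)
  obtain ⟨hlim, hc⟩ := anisoKls_margin_ground hs hρ' hRk _ (xyAniso_lroSeq_le n K) hev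
  exact ⟨(hasEvenTorusLRO_iff _).2 (hc.trans_le hlim), hlim⟩

end Ground

/-! ### Positive temperature -/

section Thermal

/-- **[KLS1988PRL] eq. (7) for `H_K` at inverse temperature `β > 0`**: on the even torus of side
`L ≥ 4`, `K > 0` (`d ≥ 1`),
`ē_K(β)/κ_K ≤ |Λ|⁻¹ĝ¹_β(0) + ½(ē_K(β)/κ_K)^{1/2} R^K_L + (2β)⁻¹ J^K_L` (Dyson–Lieb–Simon infrared
bound in Kubo form + weighted sum rule). [cite: KLS1988PRL, eq. (7)]
[cite: DysonLiebSimon1978, Thm. 5.1] [cite: KLS1988JSP, p. 1020] -/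
theorem xyAniso_kls_ineq7_thermal (hd : 1 ≤ d) (L : ℕ) [NeZero L] (n : ℕ) {K : Fin d → ℝ}
    (hK : ∀ i, 0 < K i) (hL : Even L) (h4 : 4 ≤ L) {β : ℝ} (hβ : 0 < β) :
    (∑ i, K i * gibbsDirBondCorr β (xyAnisoTorus L n K) 0 i) / (∑ i, K i) ≤
      gibbsStructureFactor β (xyAnisoTorus L n K) 0 0 / (L : ℝ) ^ d +
        1 / 2 * Real.sqrt ((∑ i, K i * gibbsDirBondCorr β (xyAnisoTorus L n K) 0 i) / ∑ i, K i) *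
          anisoKlsRiemannSum K L +
        1 / (2 * β) * anisoKlsThermalSum K L :=
  anisoKls_ineq7_thermal hd L hK hβ (fun q => gibbsStructureFactor β (xyAnisoTorus L n K) 0 q)
    (fun q hq => xyAniso_infraredBound_thermal_kubo L n K hL h4 hK hβ q hq)
    (by
      simpa only [anisoCosSum] using
        gibbsStructureFactor_weightedSumRule β (xyAnisoTorus_isHermitian L n K) K 0)

/-- **Long-range order at low temperature for direction-dependent couplings** (Dyson–Lieb–Simon /
Kennedy–Lieb–Shastry for `H_K`, modulo the lattice integrals): `d ≥ 1`, `K > 0`, spin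
`S = n/2 ≥ ½`; if eventually `R^K_L ≤ ρ` with `ρ < n√2/2` and `J^K_L ≤ 𝒯` (the latter is where
`d ≥ 3` enters), then there is `β₀ > 0` such that for every `β ≥ β₀` the Gibbs states of `H_K` on
the even tori have long-range order: `liminf_k (2k)^{-2d}Σ_{x,y}Re⟨S¹_xS¹_y + S²_xS²_y⟩_β > 0`.
[cite: DysonLiebSimon1978, Thms. 5.1, 5.2] [cite: KLS1988PRL, Theorem, eqs. (7)–(8)]
[cite: KLS1988JSP, p. 1020] -/
theorem xyAniso_longRangeOrder_thermal (hd : 1 ≤ d) {K : Fin d → ℝ} (hK : ∀ i, 0 < K i) {n : ℕ}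
    (hn : 1 ≤ n) {ρ 𝒯 : ℝ} (hρ : ρ < n * Real.sqrt 2 / 2) (h𝒯 : 0 ≤ 𝒯)
    (hR : ∀ᶠ L : ℕ in atTop, anisoKlsRiemannSum K L ≤ ρ)
    (hJ : ∀ᶠ L : ℕ in atTop, anisoKlsThermalSum K L ≤ 𝒯) :
    ∃ β₀ : ℝ, 0 < β₀ ∧ ∀ β : ℝ, β₀ ≤ β →
      HasEvenTorusLRO (fun L x y => xyAnisoThermalCorr β K L n x y) := by
  set s : ℝ := ((n : ℝ) / 2) ^ 2 / 2 with hs_def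
  set κ : ℝ := ∑ i, K i with hκ_def
  have hn1 : (1 : ℝ) ≤ n := by exact_mod_cast hn
  have hs : 0 < s := by positivity
  have hκ : 0 < κ := sum_coupling_pos hd hK
  have hρ' : ρ < 2 * Real.sqrt s := by rw [hs_def, sqrt_half_sq]; linarith
  set ℓ : ℝ := Real.log ((n : ℝ) + 1) / (2 * κ) with hℓ_def
  have hℓ : 0 ≤ ℓ := div_nonneg (Real.log_nonneg (by linarith)) (by positivity)
  have hRk : ∀ᶠ k : ℕ in atTop, anisoKlsRiemannSum K (2 * k) ≤ ρ :=
    tendsto_two_mul_atTop'.eventually hR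
  have hJk : ∀ᶠ k : ℕ in atTop, anisoKlsThermalSum K (2 * k) ≤ 𝒯 :=
    tendsto_two_mul_atTop'.eventually hJ
  obtain ⟨β₀, hβ₀, hmar⟩ := anisoKls_margin_thermal hs hℓ hρ' h𝒯
    (fun k => anisoKlsRiemannSum_nonneg K (2 * k)) hRk hJk
  refine ⟨β₀, hβ₀, fun β hβ => ?_⟩
  have hβpos : 0 < β := hβ₀.trans_le hβ
  -- eventually: eq. (7) at `β`, the energy–entropy bound, and the order parameter
  have hev : ∀ᶠ k : ℕ in atTop, ∃ e g : ℝ,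
      (∑ x ∈ halfOpenBox d (2 * k), ∑ y ∈ halfOpenBox d (2 * k),
          torusPullback (fun L x y => xyAnisoThermalCorr β K L n x y) (2 * k) x y) /
          ((halfOpenBox d (2 * k)).card : ℝ) ^ 2 = 2 * g ∧
        e ≤ g + 1 / 2 * Real.sqrt e * anisoKlsRiemannSum K (2 * k) +
          1 / (2 * β) * anisoKlsThermalSum K (2 * k) ∧ s - ℓ / β ≤ e := by
    filter_upwards [eventually_ge_atTop 2] with k hk2
    haveI : NeZero (2 * k) := ⟨by omega⟩
    refine ⟨(∑ i, K i * gibbsDirBondCorr β (xyAnisoTorus (2 * k) n K) 0 i) / κ,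
      gibbsStructureFactor β (xyAnisoTorus (2 * k) n K) 0 0 / ((2 * k : ℕ) : ℝ) ^ d,
      xyAniso_thermal_lroSeq_eq β n K k (by omega),
      xyAniso_kls_ineq7_thermal hd (2 * k) n hK ⟨k, by ring⟩ (by omega) hβpos, ?_⟩
    have hκ0 : κ ≠ 0 := hκ.ne'
    have hβ0 : β ≠ 0 := hβpos.ne'
    rw [le_div_iff₀ hκ, show (s - ℓ / β) * κ = ((n : ℝ) / 2) ^ 2 / 2 * κ -
      Real.log ((n : ℝ) + 1) / (2 * β) by rw [hs_def, hℓ_def]; field_simp]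
    exact xyAniso_weightedBondCorr_lower_thermal (2 * k) n K (by omega) hβpos
  obtain ⟨hlim, hc⟩ := hmar β hβ _ _ (xyAniso_thermal_lroSeq_le β n K) hev
  exact (hasEvenTorusLRO_iff _).2 (hc.trans_le hlim)

end Thermal

/-! ### `d ≥ 3`: the thermal Riemann sum is dominated by the torus Green function -/

section ThreeLe

/-- **`J^K_L ≤ T_L/m`** for `0 < m ≤ Kᵢ` (`d ≥ 1`): `{C_K(q)}₊ ≤ κ_K` and `E^K_q ≥ m E_q`, so the
thermal Riemann sum of the direction-dependent model is dominated by the zero-momentum-punctured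
torus Green function `T_L = |Λ|⁻¹Σ_{q≠0}E_q⁻¹` (`torusGreen 0`) of the isotropic lattice.
[cite: DysonLiebSimon1978, Thm. 5.1] [cite: KLS1988JSP, p. 1020] -/
theorem anisoKlsThermalSum_le_torusGreen_div (hd : 1 ≤ d) (L : ℕ) [NeZero L] {K : Fin d → ℝ}
    {m : ℝ} (hm : 0 < m) (hmK : ∀ i, m ≤ K i) :
    anisoKlsThermalSum K L ≤ torusGreen (0 : TorusSite d L) / m := by
  have hK : ∀ i, 0 < K i := fun i => hm.trans_le (hmK i)
  have hκ : 0 < ∑ i, K i := sum_coupling_pos hd hK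
  have hκ0 : (∑ i, K i) ≠ 0 := hκ.ne'
  rw [anisoKlsThermalSum_of_neZero, torusGreen_zero_eq, div_right_comm]
  refine div_le_div_of_nonneg_right ?_ (by positivity)
  rw [le_div_iff₀ hm, sum_mul]
  refine sum_le_sum fun q hq => ?_
  have hq0 : q ≠ 0 := (mem_erase.1 hq).1
  have hE : 0 < dispersion (latticeMomentum L q) := dispersion_latticeMomentum_pos hq0
  have hEK : 0 < NVectorAniso.anisoDispersion K (latticeMomentum L q) :=
    anisoDispersion_latticeMomentum_pos L hK hq0
  have hEK0 : NVectorAniso.anisoDispersion K (latticeMomentum L q) ≠ 0 := hEK.ne'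
  have hmE : m * dispersion (latticeMomentum L q) ≤
      NVectorAniso.anisoDispersion K (latticeMomentum L q) := by
    rw [dispersion, NVectorAniso.anisoDispersion, mul_sum]
    exact sum_le_sum fun i _ =>
      mul_le_mul_of_nonneg_right (hmK i) (sub_nonneg.2 (Real.cos_le_one _))
  calc max (anisoCosSum K (latticeMomentum L q)) 0 /
        ((∑ i, K i) * NVectorAniso.anisoDispersion K (latticeMomentum L q)) * m
      ≤ (∑ i, K i) / ((∑ i, K i) * NVectorAniso.anisoDispersion K (latticeMomentum L q)) * m :=
        mul_le_mul_of_nonneg_right (div_le_div_of_nonneg_right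
          (max_le (anisoCosSum_le (fun i => (hK i).le) _) hκ.le) (by positivity)) hm.le
    _ = m / NVectorAniso.anisoDispersion K (latticeMomentum L q) := by
        field_simp
    _ ≤ 1 / dispersion (latticeMomentum L q) := by
        rw [div_le_div_iff₀ hEK hE, one_mul]
        exact hmE

/-- **Long-range order at low temperature, hypotheses along the even sides.** The same as
`xyAniso_longRangeOrder_thermal`, with the eventual bounds on `R^K` and `J^K` required only along
the even sides `L = 2k` on which the conclusion lives. [cite: DysonLiebSimon1978, Thms. 5.1, 5.2]
[cite: KLS1988PRL, Theorem, eqs. (7)–(8)] [cite: KLS1988JSP, p. 1020] -/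
theorem xyAniso_longRangeOrder_thermal_even (hd : 1 ≤ d) {K : Fin d → ℝ} (hK : ∀ i, 0 < K i)
    {n : ℕ} (hn : 1 ≤ n) {ρ 𝒯 : ℝ} (hρ : ρ < n * Real.sqrt 2 / 2) (h𝒯 : 0 ≤ 𝒯)
    (hR : ∀ᶠ k : ℕ in atTop, anisoKlsRiemannSum K (2 * k) ≤ ρ)
    (hJ : ∀ᶠ k : ℕ in atTop, anisoKlsThermalSum K (2 * k) ≤ 𝒯) :
    ∃ β₀ : ℝ, 0 < β₀ ∧ ∀ β : ℝ, β₀ ≤ β →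
      HasEvenTorusLRO (fun L x y => xyAnisoThermalCorr β K L n x y) := by
  set s : ℝ := ((n : ℝ) / 2) ^ 2 / 2 with hs_def
  set κ : ℝ := ∑ i, K i with hκ_def
  have hn1 : (1 : ℝ) ≤ n := by exact_mod_cast hn
  have hs : 0 < s := by positivity
  have hκ : 0 < κ := sum_coupling_pos hd hK
  have hρ' : ρ < 2 * Real.sqrt s := by rw [hs_def, sqrt_half_sq]; linarith
  set ℓ : ℝ := Real.log ((n : ℝ) + 1) / (2 * κ) with hℓ_def
  have hℓ : 0 ≤ ℓ := div_nonneg (Real.log_nonneg (by linarith)) (by positivity)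
  obtain ⟨β₀, hβ₀, hmar⟩ := anisoKls_margin_thermal hs hℓ hρ' h𝒯
    (fun k => anisoKlsRiemannSum_nonneg K (2 * k)) hR hJ
  refine ⟨β₀, hβ₀, fun β hβ => ?_⟩
  have hβpos : 0 < β := hβ₀.trans_le hβ
  have hev : ∀ᶠ k : ℕ in atTop, ∃ e g : ℝ,
      (∑ x ∈ halfOpenBox d (2 * k), ∑ y ∈ halfOpenBox d (2 * k),
          torusPullback (fun L x y => xyAnisoThermalCorr β K L n x y) (2 * k) x y) /
          ((halfOpenBox d (2 * k)).card : ℝ) ^ 2 = 2 * g ∧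
        e ≤ g + 1 / 2 * Real.sqrt e * anisoKlsRiemannSum K (2 * k) +
          1 / (2 * β) * anisoKlsThermalSum K (2 * k) ∧ s - ℓ / β ≤ e := by
    filter_upwards [eventually_ge_atTop 2] with k hk2
    haveI : NeZero (2 * k) := ⟨by omega⟩
    refine ⟨(∑ i, K i * gibbsDirBondCorr β (xyAnisoTorus (2 * k) n K) 0 i) / κ,
      gibbsStructureFactor β (xyAnisoTorus (2 * k) n K) 0 0 / ((2 * k : ℕ) : ℝ) ^ d,
      xyAniso_thermal_lroSeq_eq β n K k (by omega),
      xyAniso_kls_ineq7_thermal hd (2 * k) n hK ⟨k, by ring⟩ (by omega) hβpos, ?_⟩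
    have hκ0 : κ ≠ 0 := hκ.ne'
    have hβ0 : β ≠ 0 := hβpos.ne'
    rw [le_div_iff₀ hκ, show (s - ℓ / β) * κ = ((n : ℝ) / 2) ^ 2 / 2 * κ -
      Real.log ((n : ℝ) + 1) / (2 * β) by rw [hs_def, hℓ_def]; field_simp]
    exact xyAniso_weightedBondCorr_lower_thermal (2 * k) n K (by omega) hβpos
  obtain ⟨hlim, hc⟩ := hmar β hβ _ _ (xyAniso_thermal_lroSeq_le β n K) hev
  exact (hasEvenTorusLRO_iff _).2 (hc.trans_le hlim)

/-- **Long-range order at low temperature in `d ≥ 3`, modulo the single lattice integral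
`lim R^K_L`.** For `d ≥ 3`, `K > 0`, spin `S = n/2 ≥ ½`: if eventually `R^K_L ≤ ρ` with
`ρ < n√2/2`, there is `β₀ > 0` such that for every `β ≥ β₀` the Gibbs states of `H_K` on the even
tori have long-range order — the thermal term is controlled by `J^K_L ≤ T_L/min K` and the
convergence of `T_L` to the lattice Green function in `d ≥ 3` (`torusGreen_zero_eventually_le`).
For `K = (1, 1, r)`, `r > 0`, this is the positive-temperature transition announced in
[KLS1988JSP] p. 1020 for the layered model, in the XY / hard-core-boson version, conditional only
on the value of the anisotropic KLS integral. [cite: DysonLiebSimon1978, Thms. 5.1, 5.2]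
[cite: KLS1988JSP, p. 1020] [cite: KLS1988PRL, Theorem] -/
theorem xyAniso_longRangeOrder_thermal_of_three_le (hd3 : 3 ≤ d) {K : Fin d → ℝ}
    (hK : ∀ i, 0 < K i) {n : ℕ} (hn : 1 ≤ n) {ρ : ℝ} (hρ : ρ < n * Real.sqrt 2 / 2)
    (hR : ∀ᶠ L : ℕ in atTop, anisoKlsRiemannSum K L ≤ ρ) :
    ∃ β₀ : ℝ, 0 < β₀ ∧ ∀ β : ℝ, β₀ ≤ β →
      HasEvenTorusLRO (fun L x y => xyAnisoThermalCorr β K L n x y) := by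
  have hd : 1 ≤ d := by omega
  -- the smallest coupling
  obtain ⟨i₀, -, hi₀⟩ := exists_min_image univ K ⟨⟨0, by omega⟩, mem_univ _⟩
  have hm : 0 < K i₀ := hK i₀
  have hmK : ∀ i, K i₀ ≤ K i := fun i => hi₀ i (mem_univ i)
  -- the torus Green function is eventually bounded along the even sides (`d ≥ 3`)
  obtain ⟨𝒯, k₀, h𝒯0, h𝒯⟩ := torusGreen_zero_eventually_le (d := d) hd3
  have hJ : ∀ᶠ k : ℕ in atTop, anisoKlsThermalSum K (2 * k) ≤ 𝒯 / K i₀ := by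
    filter_upwards [eventually_ge_atTop k₀, eventually_ge_atTop 1] with k hk hk1
    haveI : NeZero (2 * k) := ⟨by omega⟩
    exact (anisoKlsThermalSum_le_torusGreen_div hd (2 * k) hm hmK).trans
      (div_le_div_of_nonneg_right (h𝒯 k hk hk1) hm.le)
  exact xyAniso_longRangeOrder_thermal_even hd hK hn hρ (div_nonneg h𝒯0 hm.le)
    (tendsto_two_mul_atTop'.eventually hR) hJ

end ThreeLe

end Literature.MathematicalPhysics.QuantumLattice
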